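import Summits.Parity.GeneralizedHardyLittlewood.Theorems.GreenTaoLevelTwoGITwoCyclicInverseTensorProduct
import Literature.NumberTheory.Sieve.LinearEquationsInPrimesLevelTwoInputs

/-!
# Route `GreenTaoLevelTwo`, crux `GITwo` (stmt-Parity-21275), line `birth`, stub `stub_cyclicInverse`:
# finite tensor products of nilsequences inside the Heisenberg class (GT08a arXiv §12, Lemma 65)

Sixty-eighth helper file toward the XL stub `stub_cyclicInverse` (B. Green, T. Tao, *An inverse
theorem for the Gowers `U³(G)` norm*, arXiv:math/0503014, Thm. 68 = PEMS 51 (2008) Thm. 12.8).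
Block E17 (arXiv §12): "Now suppose we take `n₁` nilsequences coming from circle nilflows, … `n₃`
nilsequences coming from Heisenberg nilflows, and tensor them all together … Lemma 65: the tensor
product `F₁ ⊗ … ⊗ F_k` is `Kk`-Lipschitz."  The tree's Heisenberg class `InHeisClass H` is closed
under binary products; this def-free file iterates `…TensorProduct` over a `Fin k`-indexed family:

* `exists_tensor_family` — given members `X i` of the class with `1`-bounded `Mᵢ`-Lipschitz complex
  functions `Φᵢ`, elements `gᵢ` and points `pᵢ`, there is a member `Z` of the class with a
  `1`-bounded `(∑ Mᵢ)`-Lipschitz `Ψ`, `g`, `p` and `Ψ(gⁿp) = ∏ᵢ Φᵢ(gᵢⁿ pᵢ)` for all `n ∈ ℤ`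
  (the empty product is realised by the constant `1` on the circle).

References: [GreenTao2008U3Inverse] arXiv:math/0503014, §12, Lemma 65 and the paragraph before it.
-/

noncomputable section

namespace Summit.Parity.GeneralizedHardyLittlewood.GreenTaoLevelTwoGITwoCyclicInverse

open Literature.NumberTheory.Sieve
open Literature.NumberTheory.Sieve.GreenTaoLevelTwo

/-- **Finite tensor products inside the Heisenberg class (arXiv Lemma 65, iterated).**
[cite: GreenTao2008U3Inverse, §12, Lemma 65] -/
theorem exists_tensor_family (H : Nilmanifold 2) :
    ∀ (k : ℕ) (X : Fin k → Nilmanifold 2), (∀ i, InHeisClass H (X i)) →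
      ∀ (Φ : ∀ i, (X i).G ⧸ (X i).Γ → ℂ) (g : ∀ i, (X i).G) (p : ∀ i, (X i).G ⧸ (X i).Γ)
        (M : Fin k → ℝ), (∀ i, 0 ≤ M i) → (∀ i y, ‖Φ i y‖ ≤ 1) →
        (∀ i y z, ‖Φ i y - Φ i z‖ ≤ M i * (X i).dist y z) →
        ∃ Z : Nilmanifold 2, InHeisClass H Z ∧
          ∃ (Ψ : Z.G ⧸ Z.Γ → ℂ) (gZ : Z.G) (pZ : Z.G ⧸ Z.Γ),
            (∀ y, ‖Ψ y‖ ≤ 1) ∧ (∀ y z, ‖Ψ y - Ψ z‖ ≤ (∑ i, M i) * Z.dist y z) ∧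
            ∀ n : ℤ, Ψ (gZ ^ n • pZ) = ∏ i, Φ i (g i ^ n • p i) := by
  intro k
  induction k with
  | zero =>
    intro X _ Φ g p M _ _ _
    refine ⟨Nilmanifold.circle.ofLE (by norm_num : 1 ≤ 2), InHeisClass.circle, fun _ => 1, 1,
      (QuotientGroup.mk (1 : Nilmanifold.circle.G) : Nilmanifold.circle.G ⧸ Nilmanifold.circle.Γ),
      fun _ => by simp, fun y z => ?_, fun n => ?_⟩
    · simp
    · simp
  | succ k ih =>
    intro X hX Φ g p M hM hb hL
    -- the first `k` factors
    obtain ⟨Z, hZ, Ψ, gZ, pZ, hΨb, hΨL, hΨorb⟩ := ih (fun i => X (Fin.castSucc i))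
      (fun i => hX _) (fun i => Φ (Fin.castSucc i)) (fun i => g (Fin.castSucc i))
      (fun i => p (Fin.castSucc i)) (fun i => M (Fin.castSucc i)) (fun i => hM _)
      (fun i => hb _) (fun i => hL _)
    -- tensor with the last factor
    set Y := X (Fin.last k) with hY
    refine ⟨Z.prod Y, InHeisClass.prod hZ (hX (Fin.last k)), ?_⟩
    obtain ⟨p₀, hp₀⟩ := exists_quotientProdMap_eq Z Y pZ (p (Fin.last k))
    have hsum0 : 0 ≤ ∑ i : Fin k, M (Fin.castSucc i) := Finset.sum_nonneg fun i _ => hM _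
    refine ⟨fun q => Ψ (Nilmanifold.quotientProdMap Z Y q).1 *
        Φ (Fin.last k) (Nilmanifold.quotientProdMap Z Y q).2,
      ((gZ, g (Fin.last k)) : Z.G × Y.G), p₀, fun q => norm_tensor_le_one hΨb (hb _) q,
      fun q q' => ?_, fun n => ?_⟩
    · have := norm_tensor_sub_tensor_le (X := Z) (Y := Y) hsum0 (hM (Fin.last k)) hΨb (hb _)
        hΨL (hL (Fin.last k)) q q'
      rw [Fin.sum_univ_castSucc]
      exact this
    · have horb := quotientProdMap_zpow_smul Z Y ((gZ, g (Fin.last k)) : Z.G × Y.G) p₀ n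
      show Ψ _ * Φ (Fin.last k) _ = _
      rw [horb, hp₀, Fin.prod_univ_castSucc]
      simp only
      rw [hΨorb n]

end Summit.Parity.GeneralizedHardyLittlewood.GreenTaoLevelTwoGITwoCyclicInverse
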